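import Summits.ResolutionOfSingularities.ResolutionOfSingularities.Theorems.FrobeniusClosingSteerBetaNewtonSupport
import HarnessLib

/-!
# Crux `Steer` (stmt-ResolutionOfSingularities-16345), chain W4.1, β-LEAF, K-β2♭ part (II), file 8: the FACE WORDS
# `DeltaFaceGe` / `DeltaFaceGt` read on Cossart–Piltant's minimal exponent set, and the face vertex (def-free)

OURS (campaign `res-hironaka`, rung L ★L-G4, slot W4.1; statements about the route's own objects; they replace the
role of no printed item and are NOT statements of the manuscript under review [claim: Hironaka2017, status:
under-review]; AI review is weaker than expert review). Seat res-D-pv-003 (gen 7), K-β2♭ kernel owner — (II-X) C′.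

For the `x`-chart law `PreparedTransferXHat` (β-leaf of record v18.4-J4) the upstairs datum is the LOWER END `w⁻ = (δ − γ, γ)`
of the `δ`-face (words `DeltaFaceGe`, `DeltaFaceGt` of `…BetaPolygonGauge`). As for the vertex words (`…BetaNewtonSupport`), these
are read on the minimal exponent set `𝐒(f)` of the regular system of parameters `t = (x, y, z, w)`:

* `uPow_mem_deltaFaceGtIdeal` — exponents `c` with `⌊δm⌋ + 1 ≤ c₀ + c₁`, or `⌈δm⌉ ≤ c₀ + c₁ ∧ ⌊γm⌋ + 1 ≤ c₁`
  (`m = d − c₂ − c₃`), or `c₂ + c₃ ≥ d`, give monomials of the `DeltaFaceGt (δ, γ)` ideal; `deltaFaceGt_of_forall_minExponents`.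
* `forall_minExponents_of_deltaFaceGe` — `DeltaFaceGe (δ, γ)` forces every minimal exponent to satisfy `⌊δm⌋ + 1 ≤ c₀ + c₁`,
  or `⌈δm⌉ ≤ c₀ + c₁ ∧ ⌈γm⌉ ≤ c₁`, or `c₂ + c₃ ≥ d`.
* `exponent_eq_of_faceGe_of_not_faceGt` — an exponent with the `Ge`- but not the `Gt`-condition is the FACE VERTEX exponent
  `((δ − γ)m, γm, i, j)`.
* `le_sub_of_alphaGe_faceVertex` — `AlphaGe α₀` at a face vertex gives `γ ≤ δ − α₀`; `factorial_mul_faceOrdinate` — `d!·γ ∈ ℕ`.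
* `mul_uPow_faceVertex_mem_deltaFaceGtIdeal` — `𝔪 · t^a ⊆ DeltaFaceGt (δ, γ)` at the face vertex (`δ ≥ 1`).
* `not_le_vertex_exponent` — no exponent of a `BetaGt (α₁, β₁)` ideal lies below the vertex exponent `(α₁ m, β₁ m, i, j)`.

[cite: CossartPiltant2019, Prop. 2.1] [cite: CossartJannsenSaito2020, (7.4) and Lemma 12.1] No Theses file is imported; nothing
here is a route item or a registration.
-/

noncomputable section

-- `Summit.<S>.<S>.…` duplicates the summit name by design (single-problem summit).
set_option linter.dupNamespace false

namespace Summit.ResolutionOfSingularities.ResolutionOfSingularities.Theorems.SwitchingDichotomy.BetaNewton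

open IsLocalRing
open Literature.AlgebraicGeometry.Resolution
open Literature.AlgebraicGeometry.Resolution.CossartPiltant (uPow uPow_add uPow_single minExponents)
open Summit.ResolutionOfSingularities.ResolutionOfSingularities.Theorems.SwitchingDichotomy.BetaPolygon
open Summit.ResolutionOfSingularities.ResolutionOfSingularities.Theorems.SwitchingDichotomy.BetaLetter
  (uPow_four range_four monomial_mem_pow_of_le threshold_le_span_uPow deltaFace_le_poly ceil_mul_mono floor_mul_mono)

variable {S : Type} [CommRing S]

/-! ## §1 Monomials of the face ideals -/

/-- `x^a · y^b ∈ (x, y)^(a + b)`. [folklore] -/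
theorem pow_mul_pow_mem_span_pair_pow' (x y : S) (a b : ℕ) : x ^ a * y ^ b ∈ Ideal.span ({x, y} : Set S) ^ (a + b) := by
  rw [pow_add]
  exact Ideal.mul_mem_mul (Ideal.pow_mem_pow (Ideal.subset_span (by simp)) a)
    (Ideal.pow_mem_pow (Ideal.subset_span (by simp)) b)

/-- The monomials of the strict face condition lie in the `DeltaFaceGt (δ, γ)` ideal. [folklore] -/
theorem uPow_mem_deltaFaceGtIdeal (x y z w : S) (d : ℕ) (δ γ : ℚ) {c : Fin 4 → ℕ}
    (hc : d ≤ c 2 + c 3 ∨ ⌊δ * ((d - c 2 - c 3 : ℕ) : ℚ)⌋₊ + 1 ≤ c 0 + c 1 ∨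
      (⌈δ * ((d - c 2 - c 3 : ℕ) : ℚ)⌉₊ ≤ c 0 + c 1 ∧ ⌊γ * ((d - c 2 - c 3 : ℕ) : ℚ)⌋₊ + 1 ≤ c 1)) :
    uPow ![x, y, z, w] c ∈ Ideal.span {z, w} ^ d ⊔
      ⨆ (i : ℕ) (j : ℕ) (_ : i + j < d),
        (Ideal.span {x, y} ^ (⌊δ * ((d - i - j : ℕ) : ℚ)⌋₊ + 1) ⊔
          Ideal.span {y ^ (⌊γ * ((d - i - j : ℕ) : ℚ)⌋₊ + 1)} *
            Ideal.span {x, y} ^ (⌈δ * ((d - i - j : ℕ) : ℚ)⌉₊ - (⌊γ * ((d - i - j : ℕ) : ℚ)⌋₊ + 1))) *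
          Ideal.span {z ^ i * w ^ j} := by
  rw [uPow_four]
  by_cases hzw : d ≤ c 2 + c 3
  · exact Ideal.mem_sup_left (monomial_mem_pow_of_le x y z w hzw)
  · push Not at hzw
    rw [show x ^ c 0 * y ^ c 1 * z ^ c 2 * w ^ c 3 = (x ^ c 0 * y ^ c 1) * (z ^ c 2 * w ^ c 3) by ring]
    refine Ideal.mem_sup_right (Submodule.mem_iSup_of_mem (c 2) (Submodule.mem_iSup_of_mem (c 3)
      (Submodule.mem_iSup_of_mem hzw (Ideal.mul_mem_mul ?_ (Ideal.mem_span_singleton_self _)))))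
    set n : ℕ := d - c 2 - c 3 with hn
    rcases hc with hc | hc | ⟨hc1, hc2⟩
    · exact absurd hc (not_le.mpr hzw)
    · exact Ideal.mem_sup_left (Ideal.pow_le_pow_right hc (pow_mul_pow_mem_span_pair_pow' x y (c 0) (c 1)))
    · refine Ideal.mem_sup_right ?_
      rw [show x ^ c 0 * y ^ c 1 = y ^ (⌊γ * (n : ℚ)⌋₊ + 1) * (x ^ c 0 * y ^ (c 1 - (⌊γ * (n : ℚ)⌋₊ + 1))) by
        rw [mul_left_comm, ← pow_add, Nat.add_sub_cancel' hc2]]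
      refine Ideal.mul_mem_mul (Ideal.mem_span_singleton_self _) (Ideal.pow_le_pow_right ?_
        (pow_mul_pow_mem_span_pair_pow' x y (c 0) (c 1 - (⌊γ * (n : ℚ)⌋₊ + 1))))
      omega

/-- **`DeltaFaceGt` from the exponent condition on `𝐒(f)`.** [cite: CossartPiltant2019, Prop. 2.1] -/
theorem deltaFaceGt_of_forall_minExponents [IsLocalRing S] {x y z w : S} (ht : IsRsopPart ![x, y, z, w]) {d : ℕ}
    (δ γ : ℚ) {f : S}
    (h : ∀ c ∈ minExponents ![x, y, z, w] f, d ≤ c 2 + c 3 ∨ ⌊δ * ((d - c 2 - c 3 : ℕ) : ℚ)⌋₊ + 1 ≤ c 0 + c 1 ∨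
      (⌈δ * ((d - c 2 - c 3 : ℕ) : ℚ)⌉₊ ≤ c 0 + c 1 ∧ ⌊γ * ((d - c 2 - c 3 : ℕ) : ℚ)⌋₊ + 1 ≤ c 1)) :
    DeltaFaceGt x y z w d δ γ f :=
  mem_of_forall_minExponents_uPow_mem ht fun c hc => uPow_mem_deltaFaceGtIdeal x y z w d δ γ (h c hc)

/-- **`DeltaFaceGe` on `𝐒(f)`** (`δ, γ ≥ 0`): every minimal exponent is in `(z, w)^d`, strictly above the face
(`⌊δm⌋ + 1 ≤ c₀ + c₁`), or on-or-above it and not below `γ` (`⌈δm⌉ ≤ c₀ + c₁ ∧ ⌈γm⌉ ≤ c₁`). [cite: CossartPiltant2019, Prop. 2.1] -/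
theorem forall_minExponents_of_deltaFaceGe [IsLocalRing S] {x y z w : S} (ht : IsRsopPart ![x, y, z, w]) {d : ℕ}
    {δ γ : ℚ} (hδ : 0 ≤ δ) (hγ : 0 ≤ γ) {f : S} (hf : DeltaFaceGe x y z w d δ γ f) :
    ∀ c ∈ minExponents ![x, y, z, w] f, d ≤ c 2 + c 3 ∨ ⌊δ * ((d - c 2 - c 3 : ℕ) : ℚ)⌋₊ + 1 ≤ c 0 + c 1 ∨
      (⌈δ * ((d - c 2 - c 3 : ℕ) : ℚ)⌉₊ ≤ c 0 + c 1 ∧ ⌈γ * ((d - c 2 - c 3 : ℕ) : ℚ)⌉₊ ≤ c 1) := by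
  intro c hc
  have h' := threshold_le_span_uPow x y z w d
    (fun n a b => ⌊δ * (n : ℚ)⌋₊ + 1 ≤ a + b ∨ (((a + b : ℕ) : ℚ) = δ * (n : ℚ) ∧ γ * (n : ℚ) ≤ b))
    (deltaFace_le_poly x y z w d hδ γ hf)
  obtain ⟨b, hb, hbc⟩ := exists_le_of_mem_span_uPow ht h' hc
  by_cases hzw : d ≤ c 2 + c 3
  · exact Or.inl hzw
  · right
    rcases hb with hb | ⟨-, hb⟩
    · exact absurd (hb.trans (Nat.add_le_add (hbc 2) (hbc 3))) hzw
    · have h0 : b 0 ≤ c 0 := hbc 0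
      have h1 : b 1 ≤ c 1 := hbc 1
      have h2 : b 2 ≤ c 2 := hbc 2
      have h3 : b 3 ≤ c 3 := hbc 3
      have hmn : d - c 2 - c 3 ≤ d - b 2 - b 3 := by omega
      rcases hb with hb | ⟨hbeq, hbγ⟩
      · left
        exact le_trans (Nat.add_le_add_right (floor_mul_mono hδ hmn) 1) (hb.trans (Nat.add_le_add h0 h1))
      · right
        refine ⟨?_, ?_⟩
        · have : ⌈δ * ((d - b 2 - b 3 : ℕ) : ℚ)⌉₊ = b 0 + b 1 := by rw [← hbeq, Nat.ceil_natCast]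
          exact (ceil_mul_mono hδ hmn).trans (this.le.trans (Nat.add_le_add h0 h1))
        · exact (ceil_mul_mono hγ hmn).trans ((Nat.ceil_le.mpr hbγ).trans h1)

/-! ## §2 The face vertex -/

/-- **An exponent on-or-above the face end `w⁻ = (δ − γ, γ)` but not strictly beyond it is the FACE VERTEX exponent**:
`c₂ + c₃ < d`, `c₀ + c₁ = δm`, `c₁ = γm` (`m = d − c₂ − c₃`; `δ, γ ≥ 0`). [folklore] -/
theorem exponent_eq_of_faceGe_of_not_faceGt {d : ℕ} {δ γ : ℚ} (hδ : 0 ≤ δ) (hγ : 0 ≤ γ) {c : Fin 4 → ℕ}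
    (hGe : d ≤ c 2 + c 3 ∨ ⌊δ * ((d - c 2 - c 3 : ℕ) : ℚ)⌋₊ + 1 ≤ c 0 + c 1 ∨
      (⌈δ * ((d - c 2 - c 3 : ℕ) : ℚ)⌉₊ ≤ c 0 + c 1 ∧ ⌈γ * ((d - c 2 - c 3 : ℕ) : ℚ)⌉₊ ≤ c 1))
    (hGt : ¬ (d ≤ c 2 + c 3 ∨ ⌊δ * ((d - c 2 - c 3 : ℕ) : ℚ)⌋₊ + 1 ≤ c 0 + c 1 ∨
      (⌈δ * ((d - c 2 - c 3 : ℕ) : ℚ)⌉₊ ≤ c 0 + c 1 ∧ ⌊γ * ((d - c 2 - c 3 : ℕ) : ℚ)⌋₊ + 1 ≤ c 1))) :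
    c 2 + c 3 < d ∧ (((c 0 + c 1 : ℕ) : ℚ) = δ * ((d - c 2 - c 3 : ℕ) : ℚ)) ∧
      ((c 1 : ℚ) = γ * ((d - c 2 - c 3 : ℕ) : ℚ)) := by
  push Not at hGt
  obtain ⟨hzw, hfl, himp⟩ := hGt
  rcases hGe with h | h | ⟨h1, h2⟩
  · exact absurd h (not_le.mpr hzw)
  · exact absurd h (not_le.mpr hfl)
  set n : ℕ := d - c 2 - c 3 with hn
  have hδn : 0 ≤ δ * (n : ℚ) := mul_nonneg hδ (Nat.cast_nonneg n)
  have hγn : 0 ≤ γ * (n : ℚ) := mul_nonneg hγ (Nat.cast_nonneg n)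
  have hfl' : c 0 + c 1 ≤ ⌊δ * (n : ℚ)⌋₊ := Nat.lt_succ_iff.mp hfl
  have hb : c 1 ≤ ⌊γ * (n : ℚ)⌋₊ := Nat.lt_succ_iff.mp (himp h1)
  refine ⟨hzw, ?_, ?_⟩
  · exact le_antisymm ((Nat.cast_le.mpr hfl').trans (Nat.floor_le hδn)) (Nat.ceil_le.mp h1)
  · exact le_antisymm ((Nat.cast_le.mpr hb).trans (Nat.floor_le hγn)) (Nat.ceil_le.mp h2)

/-- **`γ ≤ δ − α₀` at a face vertex** lying on-or-right of the column `a = α₀`. [folklore] -/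
theorem le_sub_of_alphaGe_faceVertex {d : ℕ} {δ γ α₀ : ℚ} {c : Fin 4 → ℕ} (hzw : c 2 + c 3 < d)
    (h01 : ((c 0 + c 1 : ℕ) : ℚ) = δ * ((d - c 2 - c 3 : ℕ) : ℚ)) (h1 : (c 1 : ℚ) = γ * ((d - c 2 - c 3 : ℕ) : ℚ))
    (hα : d ≤ c 2 + c 3 ∨ ⌈α₀ * ((d - c 2 - c 3 : ℕ) : ℚ)⌉₊ ≤ c 0) : γ ≤ δ - α₀ := by
  rcases hα with h | h
  · omega
  · set m : ℕ := d - c 2 - c 3 with hm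
    have hm1 : (0 : ℚ) < m := by exact_mod_cast (show 0 < m by omega)
    have h0 : α₀ * (m : ℚ) ≤ c 0 := Nat.ceil_le.mp h
    push_cast at h01
    have : (γ + α₀) * (m : ℚ) ≤ δ * m := by nlinarith
    have := le_of_mul_le_mul_right this hm1
    linarith

/-- **`d! · γ ∈ ℕ`** at a face vertex: `γ m = c₁` with `1 ≤ m ≤ d`. [folklore] -/
theorem factorial_mul_faceOrdinate {d : ℕ} {γ : ℚ} {c : Fin 4 → ℕ} (hzw : c 2 + c 3 < d)
    (h1 : (c 1 : ℚ) = γ * ((d - c 2 - c 3 : ℕ) : ℚ)) : ∃ n : ℕ, (d.factorial : ℚ) * γ = n := by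
  set m : ℕ := d - c 2 - c 3 with hm
  have hm0 : 0 < m := by omega
  have hmd : m ≤ d := by omega
  obtain ⟨e, he⟩ := Nat.dvd_factorial hm0 hmd
  refine ⟨e * c 1, ?_⟩
  have hmQ : (m : ℚ) ≠ 0 := by exact_mod_cast hm0.ne'
  have hγ : γ = (c 1 : ℚ) / m := by rw [h1]; field_simp
  rw [hγ, he]
  push_cast
  field_simp

/-! ## §3 `𝔪 · (face vertex monomial) ⊆ DeltaFaceGt`; no strict exponent below a vertex exponent -/

/-- **`𝔪 · t^c ⊆ DeltaFaceGt (δ, γ)`** for the face vertex exponent `c = ((δ − γ)m, γm, i, j)` (`δ ≥ 1`).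
[folklore] -/
theorem mul_uPow_faceVertex_mem_deltaFaceGtIdeal [IsLocalRing S] {x y z w : S}
    (hspan : Ideal.span {x, y, z, w} = maximalIdeal S) {d : ℕ} {δ γ : ℚ} (hδ : 1 ≤ δ)
    {c : Fin 4 → ℕ} (hzw : c 2 + c 3 < d) (h01 : ((c 0 + c 1 : ℕ) : ℚ) = δ * ((d - c 2 - c 3 : ℕ) : ℚ))
    (h1 : (c 1 : ℚ) = γ * ((d - c 2 - c 3 : ℕ) : ℚ)) {s : S} (hs : s ∈ maximalIdeal S) :
    s * uPow ![x, y, z, w] c ∈ Ideal.span {z, w} ^ d ⊔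
      ⨆ (i : ℕ) (j : ℕ) (_ : i + j < d),
        (Ideal.span {x, y} ^ (⌊δ * ((d - i - j : ℕ) : ℚ)⌋₊ + 1) ⊔
          Ideal.span {y ^ (⌊γ * ((d - i - j : ℕ) : ℚ)⌋₊ + 1)} *
            Ideal.span {x, y} ^ (⌈δ * ((d - i - j : ℕ) : ℚ)⌉₊ - (⌊γ * ((d - i - j : ℕ) : ℚ)⌋₊ + 1))) *
          Ideal.span {z ^ i * w ^ j} := by
  rw [← hspan, ← range_four] at hs
  obtain ⟨cf, rfl⟩ := Ideal.mem_span_range_iff_exists_fun.mp hs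
  rw [Finset.sum_mul]
  refine Ideal.sum_mem _ fun l _ => ?_
  rw [mul_assoc, ← uPow_single ![x, y, z, w] l, ← uPow_add, add_comm (Pi.single l 1)]
  refine Ideal.mul_mem_left _ _ (uPow_mem_deltaFaceGtIdeal x y z w d δ γ ?_)
  set n : ℕ := d - c 2 - c 3 with hn
  have hn1 : 1 ≤ n := by omega
  have hfl01 : ⌊δ * (n : ℚ)⌋₊ = c 0 + c 1 := by rw [← h01, Nat.floor_natCast]
  have hce01 : ⌈δ * (n : ℚ)⌉₊ = c 0 + c 1 := by rw [← h01, Nat.ceil_natCast]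
  have hfl1 : ⌊γ * (n : ℚ)⌋₊ = c 1 := by rw [← h1, Nat.floor_natCast]
  -- the `z`/`w` cases: the slot drops by one, `δ (n − 1) < δ n = c₀ + c₁`
  have hzwcase : ∀ n' : ℕ, n' + 1 = n → ⌊δ * (n' : ℚ)⌋₊ + 1 ≤ c 0 + c 1 := by
    intro n' hn'
    have hcast : (n : ℚ) = n' + 1 := by rw [← hn']; push_cast; ring
    have hlt : δ * (n' : ℚ) < ((c 0 + c 1 : ℕ) : ℚ) := by rw [h01, hcast]; nlinarith
    push_cast at hlt
    exact Nat.succ_le_of_lt ((Nat.floor_lt (mul_nonneg (by linarith) (Nat.cast_nonneg n'))).mpr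
      (by exact_mod_cast hlt))
  obtain rfl | rfl | rfl | rfl : l = 0 ∨ l = 1 ∨ l = 2 ∨ l = 3 := by fin_cases l <;> simp
  · right; left
    simp only [Pi.add_apply, Pi.single_eq_same, Pi.single_eq_of_ne (show (1 : Fin 4) ≠ 0 by decide),
      Pi.single_eq_of_ne (show (2 : Fin 4) ≠ 0 by decide), Pi.single_eq_of_ne (show (3 : Fin 4) ≠ 0 by decide), add_zero]
    rw [hfl01]; omega
  · right; right
    simp only [Pi.add_apply, Pi.single_eq_same, Pi.single_eq_of_ne (show (0 : Fin 4) ≠ 1 by decide),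
      Pi.single_eq_of_ne (show (2 : Fin 4) ≠ 1 by decide), Pi.single_eq_of_ne (show (3 : Fin 4) ≠ 1 by decide), add_zero]
    rw [hce01, hfl1]; omega
  · simp only [Pi.add_apply, Pi.single_eq_same, Pi.single_eq_of_ne (show (0 : Fin 4) ≠ 2 by decide),
      Pi.single_eq_of_ne (show (1 : Fin 4) ≠ 2 by decide), Pi.single_eq_of_ne (show (3 : Fin 4) ≠ 2 by decide), add_zero]
    by_cases hd : d ≤ c 2 + 1 + c 3
    · exact Or.inl hd
    · right; left
      rw [show d - (c 2 + 1) - c 3 = n - 1 by omega]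
      exact hzwcase (n - 1) (by omega)
  · simp only [Pi.add_apply, Pi.single_eq_same, Pi.single_eq_of_ne (show (0 : Fin 4) ≠ 3 by decide),
      Pi.single_eq_of_ne (show (1 : Fin 4) ≠ 3 by decide), Pi.single_eq_of_ne (show (2 : Fin 4) ≠ 3 by decide), add_zero]
    by_cases hd : d ≤ c 2 + (c 3 + 1)
    · exact Or.inl hd
    · right; left
      rw [show d - c 2 - (c 3 + 1) = n - 1 by omega]
      exact hzwcase (n - 1) (by omega)

/-- **No exponent of a `BetaGt (α₁, β₁)` ideal lies below the vertex exponent `e = (α₁ m, β₁ m, i, j)`** (`α₁, β₁ ≥ 0`).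
[folklore] -/
theorem not_le_vertex_exponent {d : ℕ} {α₁ β₁ : ℚ} (hα : 0 ≤ α₁) (hβ : 0 ≤ β₁) {e : Fin 4 → ℕ} (hzw : e 2 + e 3 < d)
    (he0 : (e 0 : ℚ) = α₁ * ((d - e 2 - e 3 : ℕ) : ℚ)) (he1 : (e 1 : ℚ) = β₁ * ((d - e 2 - e 3 : ℕ) : ℚ))
    {b : Fin 4 → ℕ}
    (hb : d ≤ b 2 + b 3 ∨ (b 2 + b 3 < d ∧ (⌊α₁ * ((d - b 2 - b 3 : ℕ) : ℚ)⌋₊ + 1 ≤ b 0 ∨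
      (⌈α₁ * ((d - b 2 - b 3 : ℕ) : ℚ)⌉₊ ≤ b 0 ∧ ⌊β₁ * ((d - b 2 - b 3 : ℕ) : ℚ)⌋₊ + 1 ≤ b 1)))) :
    ¬ b ≤ e := by
  intro hle
  have h0 : b 0 ≤ e 0 := hle 0; have h1 : b 1 ≤ e 1 := hle 1
  have h2 : b 2 ≤ e 2 := hle 2; have h3 : b 3 ≤ e 3 := hle 3
  set m : ℕ := d - e 2 - e 3 with hm
  set s : ℕ := d - b 2 - b 3 with hs
  have hmsQ : (m : ℚ) ≤ s := by exact_mod_cast (show m ≤ s by omega)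
  rcases hb with hb | ⟨-, hb | ⟨-, hb⟩⟩
  · omega
  · have h1Q : ((⌊α₁ * (s : ℚ)⌋₊ + 1 : ℕ) : ℚ) ≤ e 0 := by exact_mod_cast hb.trans h0
    push_cast at h1Q
    have := mul_le_mul_of_nonneg_left hmsQ hα
    linarith [Nat.lt_floor_add_one (α₁ * (s : ℚ))]
  · have h1Q : ((⌊β₁ * (s : ℚ)⌋₊ + 1 : ℕ) : ℚ) ≤ e 1 := by exact_mod_cast hb.trans h1
    push_cast at h1Q
    have := mul_le_mul_of_nonneg_left hmsQ hβ
    linarith [Nat.lt_floor_add_one (β₁ * (s : ℚ))]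

end Summit.ResolutionOfSingularities.ResolutionOfSingularities.Theorems.SwitchingDichotomy.BetaNewton

end
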